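import Literature.NumberTheory.NumberFields.UnramifiedHomsClassGroupPRankBoundSharp
import Literature.NumberTheory.IwasawaTheory.UnramifiedHomsZpTowerFinite
import Literature.NumberTheory.IwasawaTheory.ClassicalMuInvariant
import Literature.NumberTheory.IwasawaTheory.ZpExtensionTotallyRamifiedFrom
import Literature.NumberTheory.EllipticCurves.GreenbergVatsal2000.UnramifiedOutsideFinite
import Literature.NumberTheory.EllipticCurves.IwasawaSelmerControlCokerProofs
import Literature.NumberTheory.EllipticCurves.H1TrivialAction
import Literature.NumberTheory.EllipticCurves.PeriodIndexCorestrictionLocal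
import Literature.NumberTheory.EllipticCurves.FineSelmerTrivialisingRestrictionProofs
import HarnessLib

/-!
# Iwasawa's `μ = 0` in character form, I: everywhere-unramified classes of `H¹(Gal(K̄/K_∞), M)` fixed by
# `γ^{pⁿ}` are counted by the class number of the layer `K_{n+k}` (proved; no definition, no named fact)

`Proofs`-style file in topic `NumberTheory/IwasawaTheory` (namespace
`Literature.NumberTheory.IwasawaTheory.ClassicalMuVanishesUnramifiedClasses`), written by the prover seat
`bsd-potss-rkm` g34 (cell `bsd-potss`, item stmt-BirchSwinnertonDyer-19196; closes nothing).  First half of the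
DISCHARGE of the named fact `IwasawaTheory.classicalMuVanishes_finite_unramifiedClasses`
(`ClassicalMuVanishesUnramifiedClasses.lean`: growth-form `μ = 0` ⟹ the everywhere-unramified classes of
`H¹(ker κ, M)` form a finite set), WITHOUT the structure theory of `Λ`-modules and without constructing the
unramified Iwasawa module `X_nr`: the finite layers are reached through Greenberg's Lemma 3.2 and counted by class
field theory at finite level.

Setting: `K` a number field, `κ` a `ℤ_p`-extension (`H = ker κ = Gal(K̄/K_∞)`, layers
`κ.layerSubgroup n = Gal(K̄/K_n)`), `M` a finite abelian `p`-group on which `Γ_K` acts TRIVIALLY, `γ` a topological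
generator (`κ γ = 1`), and `S = unramifiedOutside H M 1 ∅ ⊆ H¹(H, M)` the subgroup of classes all of whose
`Γ_K`-conjugates are unramified at (the chosen prime above) every finite place — which is exactly the set of the
named fact (`coe_unramifiedOutside_one_empty_eq`).

* §1 `cocycleOf_apply_eq_zero_of_mem_inertia` — a class of `S` is a continuous HOMOMORPHISM `H → M` killing
  `H ∩ I_𝔓` for EVERY maximal ideal `𝔓` of `\bar ℤ_K` (Greenberg–Vatsal's place-by-place condition read on all
  conjugates, tree `resOfLe_inertia_inf_eq_zero_of_mem_unramifiedOutside`).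
* §2 `exists_resOfLe_eq` — a class fixed by `conj_{γ^{pⁿ}}` is the restriction of a class of
  `H¹(Gal(K̄/K_n), M)` (Greenberg's Lemma 3.2, tree `ZpExtension.mem_range_resOfLe_of_conjH1_eq`, `cd_p ℤ_p = 1`);
  `evalH1_layer_eq_zero_of_mem_inertia` — if every ramified prime is totally ramified in `K_∞/K_{n₀}`
  (`TotallyRamifiedFrom κ n₀`, tree `exists_totallyRamifiedFrom`), `n ≥ n₀` and `p^k M = 0`, the extended
  homomorphism `Gal(K̄/K_n) → M` kills `Gal(K̄/K_{n+k}) ∩ I_𝔓` for every `𝔓`: an inertial element `u` of the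
  layer `n+k` is `j^{p^k} h` with `j ∈ I_𝔓 ∩ Gal(K̄/K_n)` and `h ∈ I_𝔓 ∩ H` (total ramification), so the value
  is `p^k · y(j) + c(h) = 0` (Washington §13.3: «`L̃ K_{n+1}/K_{n+1}` is unramified»).
* §3 **`finsetCard_le_pow_classNumberPExp`** — hence every finite set of classes of `S` fixed by `conj_{γ^{pⁿ}}`
  (`n ≥ n₀`) has at most `#M ^ e_{n+k}` elements, `e_m = ord_p #Cl(K_m)` (`classNumberPExp κ m`): the classes give
  distinct everywhere-unramified continuous homomorphisms on `Gal(K̄/K_{n+k})`, counted by the SHARP CFT count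
  `UnramifiedHomsClassGroupPRankBoundSharp.card_le_pow_padicValNat_card_classGroup_of_unramified`
  (`#T ≤ #M ^ ord_p #Cl`; `p` odd or `K` totally complex).

The second half (`ClassicalMuVanishesUnramifiedClassesProofs.lean`) bounds the same sets from BELOW on the
`p`-torsion classes through the locally nilpotent operator `conj_γ − 1` and concludes with the growth form.

References: [Washington1997] §13.3 (Lemma 13.15, Prop. 13.22–13.23, and the proof of Thm. 13.13: `rank_p` of the
layers via unramified extensions of exponent `p`); [Lang1990] Ch. 5 §4 (pp. 137–143: `C_n ≈ Gal(M_n/K_n)`,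
`G_C = Gal(M_∞/K_∞)`); [GreenbergLNM1716] §3 Lemma 3.2; [GreenbergVatsal2000] §2 pp. 16–17;
[NeukirchANT1999] Ch. I §9 (9.1); [SerreGaloisCohomology1997] I §2.3 (trivial modules: `H¹ = Hom`).
-/

set_option autoImplicit false

noncomputable section

open scoped Classical Pointwise NumberField
open NumberField IsDedekindDomain Field IntermediateField

namespace Literature.NumberTheory.IwasawaTheory.ClassicalMuVanishesUnramifiedClasses

open Literature.NumberTheory.EllipticCurves Literature.NumberTheory.EllipticCurves.GreenbergSelmer
  Literature.NumberTheory.EllipticCurves.GreenbergVatsal2000 Literature.NumberTheory.GaloisRepresentations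
  Literature.NumberTheory.NumberFields

variable {K : Type} [Field K] [NumberField K] {p : ℕ} [Fact p.Prime] (κ : ZpExtension K p)
variable {M : Type} [AddCommGroup M] [DistribMulAction (absoluteGaloisGroup K) M] [TopologicalSpace M]
  [DiscreteTopology M]

/-! ## §0 Helpers: trivial actions, evaluation of classes -/

omit [NumberField K] [TopologicalSpace M] [DiscreteTopology M] in
/-- A trivial `Γ_K`-action restricts to a trivial action of every subgroup (so that `H¹(H, M) = Hom(H, M)` for
every `H ≤ Γ_K`, Serre I §2.3). [cite: SerreGaloisCohomology1997, I §2.3 (Remark: trivial G-modules, H¹(G, A) = Hom(G, A))] -/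
theorem smul_eq_of_trivial (htriv : ∀ (σ : absoluteGaloisGroup K) (m : M), σ • m = m)
    (H : Subgroup (absoluteGaloisGroup K)) (x : H) (m : M) : x • m = m :=
  htriv (x : absoluteGaloisGroup K) m

omit [NumberField K] in
/-- `1` lies in no finite place: the vacuous «`v ∤ 1`» side condition of `unramifiedOutside H M 1 S₀`
(private helper). [folklore] -/
private theorem one_notMem_asIdeal (v : HeightOneSpectrum (𝓞 K)) : ((1 : ℕ) : 𝓞 K) ∉ v.asIdeal := by
  rw [Nat.cast_one]
  exact fun h => v.isPrime.ne_top ((Ideal.eq_top_iff_one _).2 h)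

/-- **The set of the named fact is Greenberg–Vatsal's `unramifiedOutside H M 1 ∅`**: classes of `H¹(H, M)` all of
whose `Γ_K`-conjugates are unramified at every finite place (the parameters `p = 1`, `S₀ = ∅` make both side
conditions of `unramifiedOutside` vacuous). [cite: GreenbergVatsal2000, §2 pp. 16–17] -/
theorem coe_unramifiedOutside_one_empty_eq (H : Subgroup (absoluteGaloisGroup K)) [H.Normal] :
    (unramifiedOutside H M 1 (∅ : Set (HeightOneSpectrum (𝓞 K))) : Set (subgroupH1 H M)) =
      {c : subgroupH1 H M | ∀ (v : HeightOneSpectrum (𝓞 K)) (σ : absoluteGaloisGroup K),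
        conjH1 H M σ c ∈ unramifiedKer H M v} := by
  ext c
  rw [SetLike.mem_coe, mem_unramifiedOutside_iff, Set.mem_setOf_eq]
  exact ⟨fun h v σ => h v (Set.notMem_empty v) (one_notMem_asIdeal v) σ, fun h v _ _ σ => h v σ⟩

omit [NumberField K] in
/-- Evaluation commutes with restriction: for `H ≤ H'` acting trivially and `y ∈ H¹(H', M)`, the homomorphism of
`res y` is the restriction of the homomorphism of `y`. [cite: SerreGaloisCohomology1997, I §2.3 (Remark: trivial modules)] -/
theorem evalH1_resOfLe {H H' : Subgroup (absoluteGaloisGroup K)} (h : H ≤ H')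
    (htrivH : ∀ (x : H) (m : M), x • m = m) (htrivH' : ∀ (x : H') (m : M), x • m = m)
    (y : subgroupH1 H' M) (x : H) :
    evalH1 htrivH x (resOfLe M h y) = evalH1 htrivH' (Subgroup.inclusion h x) y := by
  obtain ⟨f, rfl⟩ := oneCocycleClass_surjective _ y
  rw [resOfLe, resH1Hom_oneCocycleClass, evalH1_oneCocycleClass, evalH1_oneCocycleClass,
    contOneCocycles.pullback_apply]
  rfl

omit [NumberField K] in
/-- `evalH1` on a power: `y(a^N) = N • y(a)` (the class is a homomorphism; private helper). [folklore] -/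
private theorem evalH1_pow {H : Subgroup (absoluteGaloisGroup K)} (htrivH : ∀ (x : H) (m : M), x • m = m)
    (y : subgroupH1 H M) (a : H) (N : ℕ) : evalH1 htrivH (a ^ N) y = N • evalH1 htrivH a y := by
  induction N with
  | zero =>
    have h := evalH1_mul htrivH (1 : H) 1 y
    rw [mul_one, left_eq_add] at h
    rw [pow_zero, zero_smul, h]
  | succ N ih => rw [pow_succ, evalH1_mul, ih, succ_nsmul]

/-! ## §1 A class of `S` is a homomorphism killing every inertia group `H ∩ I_𝔓` -/

/-- **Classes of `S = unramifiedOutside H M 1 ∅` die on EVERY inertia group** (trivial action on `M`): for a maximal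
ideal `𝔓` of `\bar ℤ_K` and `x ∈ H ∩ I_𝔓`, the homomorphism of `c ∈ S` vanishes at `x` — `𝔓` lies over a
finite place `v`, and the Greenberg–Vatsal condition at all conjugates kills `I_𝔓 ∩ H`
(`resOfLe_inertia_inf_eq_zero_of_mem_unramifiedOutside`); for a trivial action the coboundary is `0`.
[cite: GreenbergVatsal2000, §2 pp. 16–17] [cite: NeukirchANT1999, Ch. I §9 Prop. (9.1)] -/
theorem cocycleOf_apply_eq_zero_of_mem_inertia (htriv : ∀ (σ : absoluteGaloisGroup K) (m : M), σ • m = m)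
    (H : Subgroup (absoluteGaloisGroup K)) [H.Normal] {c : subgroupH1 H M}
    (hc : c ∈ unramifiedOutside H M 1 (∅ : Set (HeightOneSpectrum (𝓞 K))))
    (𝔓 : Ideal (absIntegers (𝓞 K) K)) [𝔓.IsMaximal] (x : H)
    (hx : (x : absoluteGaloisGroup K) ∈ 𝔓.inertia (absoluteGaloisGroup K)) :
    evalH1 (smul_eq_of_trivial htriv H) x c = 0 := by
  obtain ⟨v, hv⟩ := FineSelmerTrivialisingRestriction.exists_mem_primesAbove_of_isMaximal 𝔓
  have h1 := resOfLe_inertia_inf_eq_zero_of_mem_unramifiedOutside (p := 1)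
    (S₀ := (∅ : Set (HeightOneSpectrum (𝓞 K)))) hc (Set.notMem_empty v) (one_notMem_asIdeal v) hv
  rw [← oneCocycleClass_cocycleOf (smul_eq_of_trivial htriv H) c,
    CocycleCriteria.resOfLe_oneCocycleClass_eq_zero_iff] at h1
  obtain ⟨a, ha⟩ := h1
  have h2 := ha ⟨(x : absoluteGaloisGroup K), Subgroup.mem_inf.2 ⟨hx, x.2⟩⟩
  have hincl : Subgroup.inclusion (inf_le_right : 𝔓.inertia (absoluteGaloisGroup K) ⊓ H ≤ H)
      ⟨(x : absoluteGaloisGroup K), Subgroup.mem_inf.2 ⟨hx, x.2⟩⟩ = x := Subtype.ext rfl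
  rw [hincl] at h2
  change (cocycleOf H M (smul_eq_of_trivial htriv H) c).1 x = 0
  rw [h2, sub_eq_zero]
  exact htriv _ a

/-! ## §2 Extension to a layer and absorption of the ramification above `p` -/

/-- **Greenberg's Lemma 3.2 for a trivial module**: a class of `H¹(ker κ, M)` fixed by `conj_{γ^{pⁿ}}`
(`κ γ = 1`, `M` trivial and `p`-primary) is the restriction of a class of `H¹(Gal(K̄/K_n), M)`
(tree `ZpExtension.mem_range_resOfLe_of_conjH1_eq`, `H²` of the pro-cyclic quotient vanishing).
[cite: GreenbergLNM1716, §3 Lemma 3.2] [cite: SerreGaloisCohomology1997, I §2.6 (b)] -/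
theorem exists_resOfLe_eq (htriv : ∀ (σ : absoluteGaloisGroup K) (m : M), σ • m = m)
    (hprim : ∀ m : M, ∃ k : ℕ, p ^ k • m = 0) {γ : absoluteGaloisGroup K} (hγ : κ.IsTopGenerator γ)
    (n : ℕ) (c : subgroupH1 κ.kerSubgroup M) (hc : conjH1 κ.kerSubgroup M (γ ^ p ^ n) c = c) :
    ∃ y : subgroupH1 (κ.layerSubgroup n) M, resOfLe M (κ.kerSubgroup_le_layerSubgroup n) y = c := by
  have hcont : ∀ m : M, Continuous fun g : absoluteGaloisGroup K => g • m := fun m => by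
    have : (fun g : absoluteGaloisGroup K => g • m) = fun _ => m := funext fun g => htriv g m
    rw [this]
    exact continuous_const
  exact AddMonoidHom.mem_range.1 (ZpExtension.mem_range_resOfLe_of_conjH1_eq κ hγ n hcont hprim c hc)

/-- **Absorption of the ramification.** Let every ramified prime be totally ramified in `K_∞/K_{n₀}`
(`TotallyRamifiedFrom κ n₀`), `n ≥ n₀`, `p^k M = 0`, `c ∈ S` and `y ∈ H¹(Gal(K̄/K_n), M)` with `res y = c`.
Then the homomorphism of `y` kills `Gal(K̄/K_{n+k}) ∩ I_𝔓` for EVERY maximal ideal `𝔓` of `\bar ℤ_K`: if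
`I_𝔓 ≤ ker κ` the value is a value of `c`; otherwise `Gal(K̄/K_{n₀}) ≤ I_𝔓 · ker κ`, so an inertial `u` of the
layer `n+k` (`κ u = p^{n+k} z`) is `j^{p^k} · h` with `j ∈ I_𝔓 ∩ Gal(K̄/K_n)` (`κ j = p^n z`) and
`h ∈ I_𝔓 ∩ ker κ`, whence `y(u) = p^k · y(j) + c(h) = 0`.  (Washington §13.3, proof of Lemma 13.15/13.18:
beyond the totally ramified level an exponent-`p^k` extension becomes unramified `k` layers up.)
[cite: Washington1997, §13.3 (Lemma 13.15, Lemma 13.18)] [cite: Lang1990, Ch. 5 §4 (pp. 137–143)] -/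
theorem evalH1_layer_eq_zero_of_mem_inertia (htriv : ∀ (σ : absoluteGaloisGroup K) (m : M), σ • m = m)
    {n₀ : ℕ} (hn₀ : TotallyRamifiedFrom κ n₀) {k : ℕ} (hpM : ∀ m : M, p ^ k • m = 0)
    {n : ℕ} (hn : n₀ ≤ n) {c : subgroupH1 κ.kerSubgroup M}
    (hcS : c ∈ unramifiedOutside κ.kerSubgroup M 1 (∅ : Set (HeightOneSpectrum (𝓞 K))))
    {y : subgroupH1 (κ.layerSubgroup n) M} (hy : resOfLe M (κ.kerSubgroup_le_layerSubgroup n) y = c)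
    (𝔓 : Ideal (absIntegers (𝓞 K) K)) [𝔓.IsMaximal] (u : ↥(κ.layerSubgroup (n + k)))
    (hu : (u : absoluteGaloisGroup K) ∈ 𝔓.inertia (absoluteGaloisGroup K)) :
    evalH1 (smul_eq_of_trivial htriv (κ.layerSubgroup n))
      (Subgroup.inclusion (κ.layerSubgroup_antitone (Nat.le_add_right n k)) u) y = 0 := by
  have hpr : p.Prime := Fact.out
  -- values on `ker κ ∩ I_𝔓` vanish
  have key : ∀ (h : absoluteGaloisGroup K) (hh : h ∈ κ.kerSubgroup),
      h ∈ 𝔓.inertia (absoluteGaloisGroup K) →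
        evalH1 (smul_eq_of_trivial htriv (κ.layerSubgroup n))
          ⟨h, κ.kerSubgroup_le_layerSubgroup n hh⟩ y = 0 := by
    intro h hh hI
    have e : (⟨h, κ.kerSubgroup_le_layerSubgroup n hh⟩ : ↥(κ.layerSubgroup n)) =
        Subgroup.inclusion (κ.kerSubgroup_le_layerSubgroup n) ⟨h, hh⟩ := Subtype.ext rfl
    rw [e, ← evalH1_resOfLe (κ.kerSubgroup_le_layerSubgroup n) (smul_eq_of_trivial htriv κ.kerSubgroup), hy]
    exact cocycleOf_apply_eq_zero_of_mem_inertia htriv κ.kerSubgroup hcS 𝔓 ⟨h, hh⟩ hI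
  obtain ⟨v, hv⟩ := FineSelmerTrivialisingRestriction.exists_mem_primesAbove_of_isMaximal 𝔓
  rcases hn₀ v 𝔓 hv with hI | hI
  · -- `𝔓` unramified in `K_∞/K`: `u ∈ ker κ`
    have huker : (u : absoluteGaloisGroup K) ∈ κ.kerSubgroup := hI hu
    have e : Subgroup.inclusion (κ.layerSubgroup_antitone (Nat.le_add_right n k)) u =
        ⟨(u : absoluteGaloisGroup K), κ.kerSubgroup_le_layerSubgroup n huker⟩ := Subtype.ext rfl
    rw [e]
    exact key _ huker hu
  · -- `𝔓` totally ramified in `K_∞/K_{n₀}`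
    obtain ⟨z, hz⟩ := ZpExtension.mem_layerSubgroup.1 u.2
    obtain ⟨σ, hσ⟩ := κ.surjective (Multiplicative.ofAdd ((p : ℤ_[p]) ^ n * z))
    have hσ' : κ σ = Multiplicative.ofAdd ((p : ℤ_[p]) ^ n * z) := hσ
    have hσn : σ ∈ κ.layerSubgroup n :=
      ZpExtension.mem_layerSubgroup.2 ⟨z, by rw [hσ', toAdd_ofAdd]⟩
    have hσmem : σ ∈ ((𝔓.inertia (absoluteGaloisGroup K) ⊔ κ.kerSubgroup :
        Subgroup (absoluteGaloisGroup K)) : Set (absoluteGaloisGroup K)) :=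
      hI (κ.layerSubgroup_antitone hn hσn)
    rw [Subgroup.mul_normal] at hσmem
    obtain ⟨i, hi, h, hh, hih⟩ := Set.mem_mul.1 hσmem
    have hκi : κ i = Multiplicative.ofAdd ((p : ℤ_[p]) ^ n * z) := by
      have e1 : κ σ = κ i * κ h := by rw [← hih, map_mul]
      rw [ZpExtension.mem_kerSubgroup.1 hh, mul_one] at e1
      rw [← e1, hσ']
    have hin : i ∈ κ.layerSubgroup n :=
      ZpExtension.mem_layerSubgroup.2 ⟨z, by rw [hκi, toAdd_ofAdd]⟩
    -- `κ u = κ (i ^ p^k)`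
    have hκu : κ (u : absoluteGaloisGroup K) = κ (i ^ p ^ k) := by
      apply Multiplicative.toAdd.injective
      rw [map_pow, hκi, hz, ← ofAdd_nsmul, toAdd_ofAdd, nsmul_eq_mul, Nat.cast_pow, pow_add]
      ring
    have hh'ker : (i ^ p ^ k)⁻¹ * (u : absoluteGaloisGroup K) ∈ κ.kerSubgroup := by
      rw [ZpExtension.mem_kerSubgroup, map_mul, map_inv, ← hκu, inv_mul_cancel]
    have hh'I : (i ^ p ^ k)⁻¹ * (u : absoluteGaloisGroup K) ∈ 𝔓.inertia (absoluteGaloisGroup K) :=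
      mul_mem (inv_mem (pow_mem hi _)) hu
    set iL : ↥(κ.layerSubgroup n) := ⟨i, hin⟩ with hiL
    set hL : ↥(κ.layerSubgroup n) :=
      ⟨(i ^ p ^ k)⁻¹ * (u : absoluteGaloisGroup K), κ.kerSubgroup_le_layerSubgroup n hh'ker⟩ with hhL
    have hdec : Subgroup.inclusion (κ.layerSubgroup_antitone (Nat.le_add_right n k)) u = iL ^ p ^ k * hL := by
      apply Subtype.ext
      change (u : absoluteGaloisGroup K) = i ^ p ^ k * ((i ^ p ^ k)⁻¹ * (u : absoluteGaloisGroup K))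
      rw [mul_inv_cancel_left]
    rw [hdec, evalH1_mul, evalH1_pow, hpM, zero_add]
    exact key _ hh'ker hh'I

/-! ## §3 The count: classes of `S` fixed by `γ^{pⁿ}` against the class number of `K_{n+k}` -/

omit [NumberField K] in
/-- The `m`-th layer of `κ` is the fixed field of `κ⁻¹(p^m ℤ_p)` (the transport `toAlgEquiv` in the definition of
`ZpExtension.layer` is the identity). [cite: Washington1997, §13.1] -/
theorem fixedField_layerSubgroup_eq_layer (m : ℕ) :
    (fixedField (κ.layerSubgroup m) : IntermediateField K (AlgebraicClosure K)) = κ.layer m := by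
  have hmap : ∀ H : Subgroup (absoluteGaloisGroup K),
      H.map (absoluteGaloisGroup.toAlgEquiv K).toMonoidHom = H := by
    intro H
    ext x
    constructor
    · rintro ⟨y, hy, rfl⟩; exact hy
    · intro hx; exact ⟨x, hx, rfl⟩
  rw [ZpExtension.layer, hmap]

/-- **The count.** `K` a number field, `p` odd or `K` totally complex, `κ` a `ℤ_p`-extension with every ramified
prime totally ramified in `K_∞/K_{n₀}`, `M` a finite trivial `Γ_K`-module with `p^k M = 0`, `γ` a topological
generator, `n ≥ n₀`.  Every finite set `F` of classes of `S = unramifiedOutside (ker κ) M 1 ∅` fixed by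
`conj_{γ^{pⁿ}}` has **`#F ≤ #M ^ e_{n+k}`**, `e_m = ord_p #Cl(K_m) = classNumberPExp κ m`: the classes extend to
`Gal(K̄/K_n)` (§2), restrict to DISTINCT continuous homomorphisms `Gal(K̄/K_{n+k}) → M` killing every inertia group
(§2) and a common open normal subgroup (continuity), and those are at most `#M ^ ord_p #Cl(K_{n+k})` in number
(`UnramifiedHomsClassGroupPRankBoundSharp.card_le_pow_padicValNat_card_classGroup_of_unramified`).  This is the
finite-level inequality `#(G_C/p^k)^{Γ_n} ≤ #C_{n+k}`-shadow of Lang's `C_n ≈ Gal(M_n/K_n)`, obtained by class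
field theory at the finite layer only. [cite: Lang1990, Ch. 5 §4 (pp. 137–143)] [cite: Washington1997, §13.3 Prop. 13.23]
[cite: GreenbergLNM1716, §3 Lemma 3.2] -/
theorem finsetCard_le_pow_classNumberPExp (hp : p ≠ 2 ∨ NumberField.IsTotallyComplex K)
    (htriv : ∀ (σ : absoluteGaloisGroup K) (m : M), σ • m = m) [Finite M]
    {k : ℕ} (hpM : ∀ m : M, p ^ k • m = 0)
    {n₀ : ℕ} (hn₀ : TotallyRamifiedFrom κ n₀) {γ : absoluteGaloisGroup K} (hγ : κ.IsTopGenerator γ)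
    {n : ℕ} (hn : n₀ ≤ n) (F : Finset (subgroupH1 κ.kerSubgroup M))
    (hF : ∀ c ∈ F, c ∈ unramifiedOutside κ.kerSubgroup M 1 (∅ : Set (HeightOneSpectrum (𝓞 K))) ∧
      conjH1 κ.kerSubgroup M (γ ^ p ^ n) c = c) :
    F.card ≤ Nat.card M ^ classNumberPExp κ (n + k) := by
  have hpr : p.Prime := Fact.out
  have hprim : ∀ m : M, ∃ j : ℕ, p ^ j • m = 0 := fun m => ⟨k, hpM m⟩
  have hle : κ.layerSubgroup (n + k) ≤ κ.layerSubgroup n := κ.layerSubgroup_antitone (Nat.le_add_right n k)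
  have htrivH : ∀ (x : κ.kerSubgroup) (m : M), x • m = m := smul_eq_of_trivial htriv κ.kerSubgroup
  have htrivn : ∀ (x : ↥(κ.layerSubgroup n)) (m : M), x • m = m := smul_eq_of_trivial htriv _
  -- §2: extensions `y c` of the members of `F`
  have hex : ∀ c : subgroupH1 κ.kerSubgroup M, ∃ y : subgroupH1 (κ.layerSubgroup n) M,
      c ∈ F → resOfLe M (κ.kerSubgroup_le_layerSubgroup n) y = c := by
    intro c
    by_cases hc : c ∈ F
    · obtain ⟨y, hy⟩ := exists_resOfLe_eq κ htriv hprim hγ n c (hF c hc).2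
      exact ⟨y, fun _ => hy⟩
    · exact ⟨0, fun h => (hc h).elim⟩
  choose y hy using hex
  -- the homomorphisms on `U = Gal(K̄/K_{n+k})`
  let Ψ : subgroupH1 κ.kerSubgroup M → (↥(κ.layerSubgroup (n + k)) → M) :=
    fun c u => evalH1 htrivn (Subgroup.inclusion hle u) (y c)
  have hΨadd : ∀ c (u v : ↥(κ.layerSubgroup (n + k))), Ψ c (u * v) = Ψ c u + Ψ c v := by
    intro c u v
    change evalH1 htrivn (Subgroup.inclusion hle (u * v)) (y c) = _
    rw [map_mul, evalH1_mul]
  have hΨcont : ∀ c, Continuous (Ψ c) := by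
    intro c
    change Continuous fun u : ↥(κ.layerSubgroup (n + k)) =>
      (cocycleOf _ M htrivn (y c)).1 (Subgroup.inclusion hle u)
    exact (cocycleOf _ M htrivn (y c)).1.continuous.comp (continuous_inclusion hle)
  have hΨres : ∀ c ∈ F, ∀ x : κ.kerSubgroup,
      Ψ c ⟨(x : absoluteGaloisGroup K), κ.kerSubgroup_le_layerSubgroup (n + k) x.2⟩ = evalH1 htrivH x c := by
    intro c hc x
    change evalH1 htrivn (Subgroup.inclusion hle _) (y c) = _
    have e : Subgroup.inclusion hle ⟨(x : absoluteGaloisGroup K), κ.kerSubgroup_le_layerSubgroup (n + k) x.2⟩ =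
        Subgroup.inclusion (κ.kerSubgroup_le_layerSubgroup n) x := Subtype.ext rfl
    rw [e, ← evalH1_resOfLe (κ.kerSubgroup_le_layerSubgroup n) htrivH htrivn, hy c hc]
  -- `Ψ` is injective on `F`
  have hΨinj : Set.InjOn Ψ (F : Set (subgroupH1 κ.kerSubgroup M)) := by
    intro c₁ hc₁ c₂ hc₂ heq
    apply ext_of_trivial htrivH
    intro x
    change evalH1 htrivH x c₁ = evalH1 htrivH x c₂
    rw [← hΨres c₁ hc₁ x, ← hΨres c₂ hc₂ x, heq]
  set T : Finset (↥(κ.layerSubgroup (n + k)) → M) := F.image Ψ with hT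
  have hTcard : T.card = F.card := Finset.card_image_of_injOn hΨinj
  -- a common open normal subgroup killed by all members of `T`
  obtain ⟨V, hV⟩ := UnramifiedHomsZpTowerFinite.exists_openNormalSubgroup_forall_apply_eq_zero
    (κ.layerSubgroup (n + k)) M T
    (fun f hf => by
      obtain ⟨c, -, rfl⟩ := Finset.mem_image.1 hf
      exact hΨcont c)
    (fun f hf => by
      obtain ⟨c, -, rfl⟩ := Finset.mem_image.1 hf
      have h := hΨadd c 1 1
      rw [mul_one, left_eq_add] at h
      exact h)
  set W : Subgroup (absoluteGaloisGroup K) :=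
    (V : Subgroup (absoluteGaloisGroup K)) ⊓ κ.layerSubgroup (n + k) with hW
  haveI : (V : Subgroup (absoluteGaloisGroup K)).Normal := V.isNormal'
  haveI hWn : W.Normal := Subgroup.normal_inf_normal _ _
  have hUopen : IsOpen ((κ.layerSubgroup (n + k) : Subgroup (absoluteGaloisGroup K)) :
      Set (absoluteGaloisGroup K)) := κ.isOpen_layerSubgroup (n + k)
  have hWopen : IsOpen (W : Set (absoluteGaloisGroup K)) := V.isOpen.inter hUopen
  have hWU : W ≤ κ.layerSubgroup (n + k) := inf_le_right
  -- the sharp CFT count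
  have hcount := UnramifiedHomsClassGroupPRankBoundSharp.card_le_pow_padicValNat_card_classGroup_of_unramified
    p (κ.layerSubgroup (n + k)) W hp k hUopen hWopen hWU M hpM T
    (fun f hf => by
      obtain ⟨c, -, rfl⟩ := Finset.mem_image.1 hf
      exact hΨadd c)
    (fun f hf u hu => by
      obtain ⟨c, -, rfl⟩ := Finset.mem_image.1 hf
      exact hV _ hf u (Subgroup.mem_inf.1 hu).1)
    (fun f hf 𝔓 h𝔓 u hu => by
      obtain ⟨c, hc, rfl⟩ := Finset.mem_image.1 hf
      haveI := h𝔓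
      exact evalH1_layer_eq_zero_of_mem_inertia κ htriv hn₀ hpM hn (hF c hc).1 (hy c hc) 𝔓 u hu)
  rw [hTcard, fixedField_layerSubgroup_eq_layer, ← classNumberPExp_def] at hcount
  exact hcount

end Literature.NumberTheory.IwasawaTheory.ClassicalMuVanishesUnramifiedClasses

end
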